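import Summits.QuantumFields.BalabanUV.T4Continuum.Support.NE7K1LinRegionCovEnergy

/-!
# NE7K1LinRegionCov116 — row NE7 (node U5), candidate route HOM, path H1L, cell K1-lin(s): NEEDS-ESTIMATE #E1 (o3-Ω) —
# B4 PROPOSITION 2.3 (1.15)–(1.18) FOR THE TWO-CUTOFF LINE ON EVERY FINITE UNION `Ω^{(j)}` OF `L_P`-BLOCKS AND EVERY
# `Λ ⊆ Ω^{(j)}`: the short range (5.4) of `Δ_s^{(j)}(Ω) + a₂L_P^{−2}P`, condition (5.6) uniformly on the window, and the decay
# (1.16) of `C_{s,Λ}^{(j)}(Ω) = ((Δ_s^{(j)}(Ω) + a₂L_P^{−2}P)|_Λ)⁻¹` and (1.17)–(1.18) of `δC_{s,Λ}^{(j)}(Ω)`, EVERY `s ∈ [0,1]`,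
# EVERY mesh, constants in `(d, ℓ, L, a±, a₂±)` ONLY — b04's `B4RegionCov1518` §5–§8 with the fine operator generalised to the line

Lineage `b2b-balaban-t4-ne7-p2` (CRUX PROVER NE7 #2), generation 78; file 89 (the last of the (o3-Ω) set 85–89).  PRICING-NE7 v40
§291–§292's closing rule for #E1: «the box file ✓ by tree sha AND (o3-Ω) ✓ or shown unconsumed» — (o3-Ω) is typed here, not
argued away: the print's «Λ ⊂ Ω^{(k)}, X|_Λ = ΛXΛ» (1.13) by RESTRICTION of the unit-lattice operator (`covLRSub`, as b04's
`covRSub`), `Ω`'s conditions through the fine LOCAL Neumann operators of both runs (file 87's `regLine`, N-40-6 (α)).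

* §1 (5.4): **`KeffLR_entry_decay`** (`|Δ_s^{(j)}(Ω)(y,y′)| ≤ (a + a²(2∕σ)e^{δ})e^{−δ|y−y′|_∞}`, `σ = min(2,a)∕L^{d+1}`, from file 87's
  `regLine_blockPairing_bound`), **`covLR_entry_decay`**.
* §2 with file 87's Combes–Thomas rate of the window `lineRate d L a₋ a₊ = min(1, (min(2,a₋)∕L^{d+1})∕(8(d+1)L² + 8|a₊|))`
  (admissible at every `a ∈ [a₋,a₊]`, `lineRate_small`): **`covLR_hyp56`**: B4 (5.6) for
  `Δ_s^{(j)}(Ω) + a₂L_P^{−2}P` with `γ₀ = min(a₋∕(8(d+1)),1∕8)·min(2,a₂₋)∕L_P²`, `c₀(d,ℓ,L,a±,a₂₊)`, `κ = lineRate` — for EVERY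
  `n ≥ 1`, `s ∈ [0,1]`, `a ∈ [a₋,a₊]`, `a₂ ∈ [a₂₋,a₂₊]` and EVERY finite union `Ω^{(j)}` of `L_P`-blocks.
* §3 **`cov115_regionLine_form_bounds`** = (1.15); `covLRSub` (the compression `ΛXΛ` along an injection);
  **`cov116_regionLine_sub_decay ∕ _finset_decay ∕ _decay`** = (1.16) for every `Λ ⊆ Ω^{(j)}` (invertibility of the
  compression included; `B4Sect5Torus.inv_submatrix_decay` BY NAME); **`cov118_regionLine_sub_delta ∕ _finset_delta`** =
  (1.17)–(1.18) with the printed weight `dist(·, Λ^c)` (b04's `distCS`; `B4Sect5Torus.deltaC_bound` BY NAME).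
* §4 non-vacuity (`d + 1 = 4`, two-run refinement `L = 3`, next block `L_P = 2`, window `[1∕2,2]²`).

Constants: existential, closed terms in `(d, ℓ, L, a±, a₂±)` — no `s`, `n`, `Ω`, `Λ` (L-explicit per PRICING A-41-4).  HONEST FRAMING:
[folklore] (b04's Section-5 route re-run; the Combes–Thomas input is file 86's `L²` bound for the √s-extended operator); A = 0; Neumann
regions; (1.19)–(1.20) (two regions `Ω ⊂ Ω₀`) NOT typed for the line (b04 has them at `A = 0` for nested BOXES only, `B4TwoBox120`; the
line's `δG(Ω,Ω₀)` locality is the (RW) series' `NE7K1LinWalkLineDelta`); «Λ being a sum of big blocks» not imposed (formally stronger at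
`A = 0`); nothing of Bałaban's asserted; no `sorry`.  Census only; NE7 NOT PRINTED ∕ NOT PROVED; spine 0∕9; FIXED FINITE T⁴, rung (B)+1;
NOT infinite volume, NOT mass gap, NOT Clay.  HONEST DEPENDENCY: continuum YM on T⁴ ⇐ BetaPertH ∧ nine spine estimates (0/9 proved);
BetaPertH ⇐ (D1) ∧ (D4) ∧ CAP+tail; G-an2-4 gates asym, D1 and NE2/3/4.
-/

noncomputable section

open Finset Matrix

namespace Summit.QuantumFields.BalabanUV.T4Continuum.NE7K1LinRegionCov116

open Literature.MathematicalPhysics.QuantumFieldTheory.Balaban1983to89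
open Literature.MathematicalPhysics.QuantumFieldTheory.Balaban1983to89.B4ContourShift (supNorm supNorm_nonneg)
open Literature.MathematicalPhysics.QuantumFieldTheory.Balaban1983to89.B4Reflection242
open Literature.MathematicalPhysics.QuantumFieldTheory.Balaban1983to89.B4BoxCov237 (supNorm_zero' hyp56_mono)
open Literature.MathematicalPhysics.QuantumFieldTheory.Balaban1983to89.B4Lower18
open Literature.MathematicalPhysics.QuantumFieldTheory.Balaban1983to89.B4Prop31Zero (indR)
open Literature.MathematicalPhysics.QuantumFieldTheory.Balaban1983to89.B4RegionCov1518 (projL projL_entry_decay rhoS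
  rhoS_isPseudoDist rhoS_sumBound distCS distCS_nonneg distCS_le)
open Literature.MathematicalPhysics.QuantumFieldTheory.Balaban1983to89.B4Sect5Torus (IsPseudoDist SumBound Hyp56 rate rate_pos
  bigC bigC_nonneg hyp56_submatrix isUnit_of_hyp56 inv_submatrix_decay deltaC_bound)
open Literature.MathematicalPhysics.QuantumFieldTheory.Balaban1983to89.B4Sect5Proof (latticeConst latticeConst_nonneg)
open NE7K1LinRegionLine NE7K1LinRegionCovEnergy

variable {d : ℕ}

/-! ### §1 (5.4): the entries of `Δ_s^{(j)}(Ω) + a₂L_P^{−2}P` decay exponentially -/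

section Entry

variable {n : ℕ} (L : ℕ) [NeZero L] {Ω : Finset (Fin (d + 1) → ℤ)}

/-- **THE ENTRIES OF `Δ_s^{(j)}(Ω)` DECAY**, every finite `Ω^{(j)}`, every mesh, every `s ∈ [0,1]`:
`|Δ_s^{(j)}(Ω)(y,y′)| ≤ (a + a²(2∕σ)e^{δ})·e^{−δ|y − y′|_∞}`, `σ = min(2,a)∕L^{d+1}`, for every `δ` of file 86's window (b04's
`KeffR_entry_decay` with `blockPairing_bound ↦ regLine_blockPairing_bound`). [cite: CombesThomas1973, §II] [folklore] -/
theorem KeffLR_entry_decay (hn : 1 ≤ n) {a δ : ℝ} (ha : 0 < a) (hδ0 : 0 ≤ δ) (hδ1 : δ ≤ 1)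
    (hsmall : 2 * (2 * ((d : ℝ) + 1) * (δ * L) ^ 2 + a * (Real.exp δ - 1)) ≤ (min 2 a / (L : ℝ) ^ (d + 1)) / 2)
    {s : ℝ} (hs0 : 0 ≤ s) (hs1 : s ≤ 1) (y y' : ↥Ω) :
    |KeffLR L hn Ω a s y y'| ≤ (a + a ^ 2 * (2 / (min 2 a / (L : ℝ) ^ (d + 1))) * Real.exp δ) *
      Real.exp (-(δ * supNorm (y.1 - y'.1))) := by
  set σ : ℝ := min 2 a / (L : ℝ) ^ (d + 1) with hσ
  have hL0 : (0 : ℝ) < L := by exact_mod_cast (NeZero.one_le : 1 ≤ L)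
  have hσ0 : 0 < σ := div_pos (lt_min (by norm_num) ha) (by positivity)
  have hn0 : (0 : ℝ) < n := by exact_mod_cast hn
  have hG := regLine_blockPairing_bound L hn ha hδ0 hδ1 hsmall hs0 hs1 y y'
  have hentry : KeffLR L hn Ω a s y y' = a * (if y = y' then (1 : ℝ) else 0)
      - a ^ 2 * ((n : ℝ) ^ (d + 1))⁻¹ * (indR n Ω * (regLine L hn Ω a s)⁻¹ * (indR n Ω)ᵀ) y y' := by
    simp only [KeffLR, Matrix.sub_apply, Matrix.smul_apply, Matrix.one_apply, smul_eq_mul]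
  have h2 : |a ^ 2 * ((n : ℝ) ^ (d + 1))⁻¹ * (indR n Ω * (regLine L hn Ω a s)⁻¹ * (indR n Ω)ᵀ) y y'|
      ≤ a ^ 2 * (2 / σ) * Real.exp δ * Real.exp (-(δ * supNorm (y.1 - y'.1))) := by
    rw [abs_mul, abs_of_nonneg (by positivity : (0 : ℝ) ≤ a ^ 2 * ((n : ℝ) ^ (d + 1))⁻¹)]
    have hN : (n : ℝ) ^ (d + 1) ≠ 0 := by positivity
    calc a ^ 2 * ((n : ℝ) ^ (d + 1))⁻¹ * |(indR n Ω * (regLine L hn Ω a s)⁻¹ * (indR n Ω)ᵀ) y y'|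
        ≤ a ^ 2 * ((n : ℝ) ^ (d + 1))⁻¹ * ((n : ℝ) ^ (d + 1) * (2 / σ) * Real.exp δ
            * Real.exp (-(δ * supNorm (y.1 - y'.1)))) := mul_le_mul_of_nonneg_left hG (by positivity)
      _ = a ^ 2 * (2 / σ) * Real.exp δ * Real.exp (-(δ * supNorm (y.1 - y'.1))) := by
          field_simp
  have h1 : |a * (if y = y' then (1 : ℝ) else 0)| ≤ a * Real.exp (-(δ * supNorm (y.1 - y'.1))) := by
    by_cases hyy : y = y'
    · subst hyy
      rw [if_pos rfl, mul_one, abs_of_pos ha, sub_self, supNorm_zero', mul_zero, neg_zero, Real.exp_zero, mul_one]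
    · rw [if_neg hyy, mul_zero, abs_zero]
      positivity
  rw [hentry]
  calc |a * (if y = y' then (1 : ℝ) else 0)
        - a ^ 2 * ((n : ℝ) ^ (d + 1))⁻¹ * (indR n Ω * (regLine L hn Ω a s)⁻¹ * (indR n Ω)ᵀ) y y'|
      ≤ |a * (if y = y' then (1 : ℝ) else 0)|
        + |a ^ 2 * ((n : ℝ) ^ (d + 1))⁻¹ * (indR n Ω * (regLine L hn Ω a s)⁻¹ * (indR n Ω)ᵀ) y y'| :=
        abs_sub _ _
    _ ≤ a * Real.exp (-(δ * supNorm (y.1 - y'.1)))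
        + a ^ 2 * (2 / σ) * Real.exp δ * Real.exp (-(δ * supNorm (y.1 - y'.1))) := add_le_add h1 h2
    _ = (a + a ^ 2 * (2 / σ) * Real.exp δ) * Real.exp (-(δ * supNorm (y.1 - y'.1))) := by ring

/-- **THE ENTRIES OF `Δ_s^{(j)}(Ω) + a₂L_P^{−2}P` DECAY** (B4 (5.4) for the line on a region), every finite `Ω^{(j)}`, every mesh,
every `s ∈ [0,1]`: `|(Δ_s^{(j)}(Ω) + a₂L_P^{−2}P)(y,y′)| ≤ (a + a²(2∕σ)e^{δ} + a₂L_P^{−2}e^{δ(L_P−1)})·e^{−δ|y−y′|_∞}`.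
[cite: CombesThomas1973, §II] [folklore] -/
theorem covLR_entry_decay (hn : 1 ≤ n) {LP : ℕ} (hLP : 1 ≤ LP) {a a₂ δ : ℝ} (ha : 0 < a) (ha2 : 0 ≤ a₂) (hδ0 : 0 ≤ δ)
    (hδ1 : δ ≤ 1)
    (hsmall : 2 * (2 * ((d : ℝ) + 1) * (δ * L) ^ 2 + a * (Real.exp δ - 1)) ≤ (min 2 a / (L : ℝ) ^ (d + 1)) / 2)
    {s : ℝ} (hs0 : 0 ≤ s) (hs1 : s ≤ 1) (y y' : ↥Ω) :
    |covLR L hn LP Ω a a₂ s y y'|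
      ≤ (a + a ^ 2 * (2 / (min 2 a / (L : ℝ) ^ (d + 1))) * Real.exp δ + a₂ / (LP : ℝ) ^ 2 * Real.exp (δ * ((LP : ℝ) - 1)))
          * Real.exp (-(δ * supNorm (y.1 - y'.1))) := by
  have h1 := KeffLR_entry_decay L hn ha hδ0 hδ1 hsmall hs0 hs1 y y'
  have h2 := projL_entry_decay hLP Ω hδ0 y y'
  have hc : 0 ≤ a₂ / (LP : ℝ) ^ 2 := by positivity
  have hentry : covLR L hn LP Ω a a₂ s y y' = KeffLR L hn Ω a s y y' + a₂ / (LP : ℝ) ^ 2 * projL LP Ω y y' := by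
    simp only [covLR, Matrix.add_apply, Matrix.smul_apply, smul_eq_mul]
  rw [hentry]
  calc |KeffLR L hn Ω a s y y' + a₂ / (LP : ℝ) ^ 2 * projL LP Ω y y'|
      ≤ |KeffLR L hn Ω a s y y'| + |a₂ / (LP : ℝ) ^ 2 * projL LP Ω y y'| := abs_add_le _ _
    _ = |KeffLR L hn Ω a s y y'| + a₂ / (LP : ℝ) ^ 2 * |projL LP Ω y y'| := by rw [abs_mul, abs_of_nonneg hc]
    _ ≤ (a + a ^ 2 * (2 / (min 2 a / (L : ℝ) ^ (d + 1))) * Real.exp δ) * Real.exp (-(δ * supNorm (y.1 - y'.1)))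
        + a₂ / (LP : ℝ) ^ 2 * (Real.exp (δ * ((LP : ℝ) - 1)) * Real.exp (-(δ * supNorm (y.1 - y'.1)))) :=
        add_le_add h1 (mul_le_mul_of_nonneg_left h2 hc)
    _ = (a + a ^ 2 * (2 / (min 2 a / (L : ℝ) ^ (d + 1))) * Real.exp δ + a₂ / (LP : ℝ) ^ 2 * Real.exp (δ * ((LP : ℝ) - 1)))
          * Real.exp (-(δ * supNorm (y.1 - y'.1))) := by ring

end Entry

/-! ### §2 Condition (5.6) uniformly on the window (rate = file 87's `lineRate`) -/

/-- **CONDITION (5.6) FOR `Δ_s^{(j)}(Ω) + a₂L_P^{−2}P`, EVERY FINITE UNION `Ω^{(j)}` OF `L_P`-BLOCKS, EVERY `s ∈ [0,1]`, UNIFORMLY ON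
THE WINDOW**: there are `γ₀ > 0`, `c₀ ≥ 0`, `κ > 0` depending on `(d, ℓ, L, a±, a₂₊)` only — explicitly
`γ₀ = min(a₋∕(8(d+1)), 1∕8)·min(2,a₂₋)∕L_P²`, `κ = lineRate d L a₋ a₊` — such that for every `n ≥ 1`, `s ∈ [0,1]`, admissible
`a, a₂` and EVERY finite union `Ω^{(j)}` of `L_P`-blocks the operator is symmetric, `≥ γ₀` as a form and has entries
`≤ c₀e^{−κ|y − y′|_∞}` (b04's `covR_hyp56` for the line). [folklore] -/
theorem covLR_hyp56 (d ℓ L : ℕ) [NeZero L] (hℓ : 1 ≤ ℓ) (amin aplus a2min a2plus : ℝ) (ha : 0 < amin) (ha2 : 0 < a2min) :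
    ∃ γ₀ c₀ κ : ℝ, 0 < γ₀ ∧ 0 ≤ c₀ ∧ 0 < κ ∧
      γ₀ = min (amin / (8 * (d + 1))) (1 / 8) * (min 2 a2min / ((ℓ : ℝ) + 1) ^ 2) ∧
      κ = lineRate d L amin aplus ∧
      ∀ (n : ℕ) (hn : 1 ≤ n) (s a a₂ : ℝ), 0 ≤ s → s ≤ 1 → amin ≤ a → a ≤ aplus → a2min ≤ a₂ → a₂ ≤ a2plus →
        ∀ (Ω : Finset (Fin (d + 1) → ℤ)), IsBlockUnion (ℓ + 1) Ω →
          Hyp56 (rhoS Ω) (covLR L hn (ℓ + 1) Ω a a₂ s) γ₀ c₀ κ := by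
  have hL : 1 ≤ L := NeZero.one_le
  have hL0 : (0 : ℝ) < L := by exact_mod_cast hL
  set κ := lineRate d L amin aplus with hκdef
  have hκ : 0 < κ := lineRate_pos d hL aplus ha
  have hκ1 : κ ≤ 1 := lineRate_le_one d L amin aplus
  have hσ : 0 < min 2 amin := lt_min (by norm_num) ha
  set σm : ℝ := min 2 amin / (L : ℝ) ^ (d + 1) with hσm
  have hσm0 : 0 < σm := div_pos hσ (by positivity)
  set γ₀ : ℝ := min (amin / (8 * (d + 1))) (1 / 8) * (min 2 a2min / ((ℓ : ℝ) + 1) ^ 2) with hγ₀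
  set c₀ : ℝ := |aplus| + aplus ^ 2 * (2 / σm) * Real.exp κ + |a2plus| * Real.exp (κ * ℓ) with hc₀
  have hγ : 0 < γ₀ := mul_pos (lt_min (by positivity) (by norm_num)) (by
    have : 0 < min 2 a2min := lt_min (by norm_num) ha2
    positivity)
  have hc : 0 ≤ c₀ := by positivity
  refine ⟨γ₀, c₀, κ, hγ, hc, hκ, rfl, rfl, ?_⟩
  intro n hn s a a₂ hs0 hs1 h1 h2 h5 h6 Ω hΩ
  have hLP : 1 ≤ ℓ + 1 := by omega
  have ha₁ : 0 < a := lt_of_lt_of_le ha h1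
  have ha₂ : 0 ≤ a₂ := ha2.le.trans h5
  have hsmall := lineRate_small d hL ha h1 h2
  refine ⟨covLR_isSymm L hn (ℓ + 1) a a₂ s, fun v => ?_, fun p q => ?_⟩
  · have hge := covLR_form_ge L hn hLP ha₁ ha₂ hs0 hΩ v
    push_cast at hge
    have hγle : γ₀ ≤ min (a / (8 * (d + 1))) (1 / 8) * (min 2 a₂ / ((ℓ : ℝ) + 1) ^ 2) := by
      refine mul_le_mul (min_le_min ?_ le_rfl) ?_ (by positivity) (le_min (by positivity) (by norm_num))
      · exact div_le_div_of_nonneg_right h1 (by positivity)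
      · exact div_le_div_of_nonneg_right (min_le_min le_rfl h5) (by positivity)
    have hvv : ∑ p, v p ^ 2 = v ⬝ᵥ v := by
      unfold dotProduct
      exact Finset.sum_congr rfl fun p _ => by ring
    have hvv0 : 0 ≤ v ⬝ᵥ v := by
      rw [← hvv]
      exact Finset.sum_nonneg fun _ _ => sq_nonneg _
    rw [hvv]
    show γ₀ * (v ⬝ᵥ v) ≤ v ⬝ᵥ (covLR L hn (ℓ + 1) Ω a a₂ s).mulVec v
    exact (mul_le_mul_of_nonneg_right hγle hvv0).trans hge
  · unfold rhoS
    have hE := covLR_entry_decay L hn hLP ha₁ ha₂ hκ.le hκ1 hsmall hs0 hs1 p q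
    push_cast at hE
    simp only [add_sub_cancel_right] at hE
    have hX := Real.exp_pos (-(κ * supNorm (p.1 - q.1)))
    have hL2 : a₂ / ((ℓ : ℝ) + 1) ^ 2 ≤ |a2plus| :=
      calc a₂ / ((ℓ : ℝ) + 1) ^ 2 ≤ a₂ := div_le_self ha₂ (one_le_pow₀ (by linarith))
        _ ≤ a2plus := h6
        _ ≤ |a2plus| := le_abs_self _
    have hK2 : a + a ^ 2 * (2 / (min 2 a / (L : ℝ) ^ (d + 1))) * Real.exp κ ≤ |aplus| + aplus ^ 2 * (2 / σm) * Real.exp κ := by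
      have hsq : a ^ 2 ≤ aplus ^ 2 := pow_le_pow_left₀ ha₁.le h2 2
      have habs : a ≤ |aplus| := h2.trans (le_abs_self _)
      have hσ₁ : 0 < min 2 a / (L : ℝ) ^ (d + 1) := div_pos (lt_min (by norm_num) ha₁) (by positivity)
      have hdiv : 2 / (min 2 a / (L : ℝ) ^ (d + 1)) ≤ 2 / σm :=
        div_le_div_of_nonneg_left (by norm_num) hσm0 (div_le_div_of_nonneg_right (min_le_min le_rfl h1) (by positivity))
      have hprod : a ^ 2 * (2 / (min 2 a / (L : ℝ) ^ (d + 1))) ≤ aplus ^ 2 * (2 / σm) :=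
        mul_le_mul hsq hdiv (by positivity) (by positivity)
      have := mul_le_mul_of_nonneg_right hprod (Real.exp_pos κ).le
      linarith
    calc |covLR L hn (ℓ + 1) Ω a a₂ s p q|
        ≤ (a + a ^ 2 * (2 / (min 2 a / (L : ℝ) ^ (d + 1))) * Real.exp κ + a₂ / ((ℓ : ℝ) + 1) ^ 2 * Real.exp (κ * ℓ))
            * Real.exp (-(κ * supNorm (p.1 - q.1))) := hE
      _ ≤ (|aplus| + aplus ^ 2 * (2 / σm) * Real.exp κ + |a2plus| * Real.exp (κ * ℓ))
            * Real.exp (-(κ * supNorm (p.1 - q.1))) := by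
          refine mul_le_mul_of_nonneg_right (add_le_add hK2 ?_) hX.le
          exact mul_le_mul_of_nonneg_right hL2 (by positivity)
      _ = c₀ * Real.exp (-(κ * supNorm (p.1 - q.1))) := by rw [hc₀]

/-! ### §3 Proposition 2.3 (1.15)–(1.18) for the line on every finite union `Ω^{(j)}` of `L_P`-blocks and every `Λ ⊆ Ω^{(j)}` -/

/-- **B4 PROPOSITION 2.3 (1.15) FOR THE TWO-CUTOFF LINE, EVERY FINITE UNION `Ω^{(j)}` OF `L_P`-BLOCKS — HYPOTHESIS-FREE.**  For every
dimension `d + 1`, next block `L_P = ℓ + 1 ≥ 2`, two-run refinement `L ≥ 1` and parameter window there are `γ₀, γ₁ > 0`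
(explicitly `γ₀ = min(a₋∕(8(d+1)), 1∕8)·min(2,a₂₋)∕L_P²`, `γ₁ = |a₊| + |a₂₊| + 1`) such that for EVERY `n ≥ 1`, EVERY `s ∈ [0,1]`,
every `a ∈ [a₋, a₊]`, `a₂ ∈ [a₂₋, a₂₊]` and EVERY finite union `Ω^{(j)}` of `L_P`-blocks of unit sites:
`γ₀‖ψ‖² ≤ ⟨ψ, (Δ_s^{(j)}(Ω) + a₂L_P^{−2}P)ψ⟩ ≤ γ₁‖ψ‖²`. [folklore] -/
theorem cov115_regionLine_form_bounds (d ℓ L : ℕ) [NeZero L] (hℓ : 1 ≤ ℓ) (amin aplus a2min a2plus : ℝ) (ha : 0 < amin)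
    (ha2 : 0 < a2min) :
    ∃ γ₀ γ₁ : ℝ, 0 < γ₀ ∧ 0 < γ₁ ∧
      γ₀ = min (amin / (8 * (d + 1))) (1 / 8) * (min 2 a2min / ((ℓ : ℝ) + 1) ^ 2) ∧
      ∀ (n : ℕ) (hn : 1 ≤ n) (s a a₂ : ℝ), 0 ≤ s → s ≤ 1 → amin ≤ a → a ≤ aplus → a2min ≤ a₂ → a₂ ≤ a2plus →
        ∀ (Ω : Finset (Fin (d + 1) → ℤ)), IsBlockUnion (ℓ + 1) Ω →
          ∀ ψ : ↥Ω → ℝ,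
            γ₀ * (ψ ⬝ᵥ ψ) ≤ ψ ⬝ᵥ (covLR L hn (ℓ + 1) Ω a a₂ s).mulVec ψ ∧
            ψ ⬝ᵥ (covLR L hn (ℓ + 1) Ω a a₂ s).mulVec ψ ≤ γ₁ * (ψ ⬝ᵥ ψ) := by
  obtain ⟨γ₀, c₀, κ, hγ, -, -, hγ₀, -, hA⟩ := covLR_hyp56 d ℓ L hℓ amin aplus a2min a2plus ha ha2
  refine ⟨γ₀, |aplus| + |a2plus| + 1, hγ, by positivity, hγ₀, ?_⟩
  intro n hn s a a₂ hs0 hs1 h1 h2 h5 h6 Ω hΩ ψ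
  have hLP : 1 ≤ ℓ + 1 := by omega
  have ha₁ : 0 < a := lt_of_lt_of_le ha h1
  have ha₂ : 0 ≤ a₂ := ha2.le.trans h5
  have hvv : ∑ p, ψ p ^ 2 = ψ ⬝ᵥ ψ := by
    unfold dotProduct
    exact Finset.sum_congr rfl fun p _ => by ring
  have hvv0 : 0 ≤ ψ ⬝ᵥ ψ := by
    rw [← hvv]
    exact Finset.sum_nonneg fun _ _ => sq_nonneg _
  refine ⟨?_, ?_⟩
  · have h := (hA n hn s a a₂ hs0 hs1 h1 h2 h5 h6 Ω hΩ).2.1 ψ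
    rw [hvv] at h
    simpa [dotProduct] using h
  · have h := covLR_form_le L hn hLP ha₁ ha₂ hs0 hΩ ψ
    push_cast at h
    have hL2 : a₂ / ((ℓ : ℝ) + 1) ^ 2 ≤ |a2plus| :=
      calc a₂ / ((ℓ : ℝ) + 1) ^ 2 ≤ a₂ := div_le_self ha₂ (one_le_pow₀ (by linarith))
        _ ≤ a2plus := h6
        _ ≤ |a2plus| := le_abs_self _
    have hK2 : a ≤ |aplus| := h2.trans (le_abs_self _)
    have : (a + a₂ / ((ℓ : ℝ) + 1) ^ 2) * (ψ ⬝ᵥ ψ) ≤ (|aplus| + |a2plus| + 1) * (ψ ⬝ᵥ ψ) :=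
      mul_le_mul_of_nonneg_right (by linarith) hvv0
    exact h.trans this

section Sub

variable {n : ℕ} (L : ℕ) [NeZero L]

/-- **THE COMPRESSION `ΛXΛ` OF `X = Δ_s^{(j)}(Ω) + a₂L_P^{−2}P` TO A SUBSET `Λ ⊆ Ω^{(j)}`** given as an injection `e : m → Ω^{(j)}`
(B4 (1.13)'s `X|_Λ = ΛXΛ`); its inverse is `C_{s,Λ}^{(j)}(Ω)`. [folklore] -/
def covLRSub (hn : 1 ≤ n) (LP : ℕ) (Ω : Finset (Fin (d + 1) → ℤ)) (a a₂ s : ℝ) {m : Type*} (e : m → ↥Ω) :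
    Matrix m m ℝ :=
  (covLR L hn LP Ω a a₂ s).submatrix e e

/-- the compression along `e` has the entries `X(e i, e i′)`. [folklore] -/
@[simp] theorem covLRSub_apply (hn : 1 ≤ n) (LP : ℕ) (Ω : Finset (Fin (d + 1) → ℤ)) (a a₂ s : ℝ) {m : Type*}
    (e : m → ↥Ω) (i i' : m) : covLRSub L hn LP Ω a a₂ s e i i' = covLR L hn LP Ω a a₂ s (e i) (e i') := rfl

/-- the compression along the identity is the operator itself (`Λ = Ω^{(j)}`). [folklore] -/
theorem covLRSub_id (hn : 1 ≤ n) (LP : ℕ) (Ω : Finset (Fin (d + 1) → ℤ)) (a a₂ s : ℝ) :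
    covLRSub L hn LP Ω a a₂ s (id : ↥Ω → ↥Ω) = covLR L hn LP Ω a a₂ s := rfl

end Sub

/-- **B4 PROPOSITION 2.3 (1.16) FOR THE TWO-CUTOFF LINE, EVERY FINITE UNION `Ω^{(j)}` OF `L_P`-BLOCKS AND EVERY `Λ ⊆ Ω^{(j)}` —
HYPOTHESIS-FREE.**  There are `δ₀, c₀ > 0` depending on `(d, ℓ, L)` and the window only such that for EVERY `n ≥ 1`, EVERY
`s ∈ [0,1]`, every admissible `a, a₂`, EVERY finite union `Ω^{(j)}` of `L_P`-blocks and EVERY injection `e : m → Ω^{(j)}` (subset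
`Λ`): the compression `(Δ_s^{(j)}(Ω) + a₂L_P^{−2}P)|_Λ` is invertible and `|C_{s,Λ}^{(j)}(Ω; e i, e i′)| ≤ c₀·e^{−δ₀|e i − e i′|_∞}`
(`B4Sect5Torus.inv_submatrix_decay` on `covLR_hyp56`). [folklore] -/
theorem cov116_regionLine_sub_decay (d ℓ L : ℕ) [NeZero L] (hℓ : 1 ≤ ℓ) (amin aplus a2min a2plus : ℝ) (ha : 0 < amin)
    (ha2 : 0 < a2min) :
    ∃ δ c : ℝ, 0 < δ ∧ 0 < c ∧
      ∀ (n : ℕ) (hn : 1 ≤ n) (s a a₂ : ℝ), 0 ≤ s → s ≤ 1 → amin ≤ a → a ≤ aplus → a2min ≤ a₂ → a₂ ≤ a2plus →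
        ∀ (Ω : Finset (Fin (d + 1) → ℤ)), IsBlockUnion (ℓ + 1) Ω →
          ∀ {m : Type*} [Fintype m] [DecidableEq m] (e : m → ↥Ω), Function.Injective e →
            covLRSub L hn (ℓ + 1) Ω a a₂ s e * (covLRSub L hn (ℓ + 1) Ω a a₂ s e)⁻¹ = 1 ∧
            ∀ i i' : m, |(covLRSub L hn (ℓ + 1) Ω a a₂ s e)⁻¹ i i'|
              ≤ c * Real.exp (-(δ * supNorm ((e i).1 - (e i').1))) := by
  obtain ⟨γ₀, c₀, κ, hγ, hc, hκ, -, -, hA⟩ := covLR_hyp56 d ℓ L hℓ amin aplus a2min a2plus ha ha2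
  have hKn : ∀ a : ℝ, 0 < a → 0 ≤ latticeConst (d + 1) a := fun a ha => latticeConst_nonneg (d + 1) ha.le
  refine ⟨rate (latticeConst (d + 1)) γ₀ c₀ κ, 2 / γ₀, rate_pos hKn hγ hc hκ, by positivity, ?_⟩
  intro n hn s a a₂ hs0 hs1 h1 h2 h5 h6 Ω hΩ m _ _ e he
  have hAΩ := hA n hn s a a₂ hs0 hs1 h1 h2 h5 h6 Ω hΩ
  have hAe := hyp56_submatrix hAΩ he
  refine ⟨Matrix.mul_nonsing_inv _ ((Matrix.isUnit_iff_isUnit_det _).1 (isUnit_of_hyp56 hγ hAe)), fun i i' => ?_⟩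
  exact inv_submatrix_decay hKn hγ hc hκ (rhoS_isPseudoDist Ω) (rhoS_sumBound Ω) hAΩ he i i'

/-- **(1.16) for the line, `Λ ⊆ Ω^{(j)}` a `Finset` of unit sites** (the inclusion as the injection). [folklore] -/
theorem cov116_regionLine_finset_decay (d ℓ L : ℕ) [NeZero L] (hℓ : 1 ≤ ℓ) (amin aplus a2min a2plus : ℝ) (ha : 0 < amin)
    (ha2 : 0 < a2min) :
    ∃ δ c : ℝ, 0 < δ ∧ 0 < c ∧
      ∀ (n : ℕ) (hn : 1 ≤ n) (s a a₂ : ℝ), 0 ≤ s → s ≤ 1 → amin ≤ a → a ≤ aplus → a2min ≤ a₂ → a₂ ≤ a2plus →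
        ∀ (Ω : Finset (Fin (d + 1) → ℤ)), IsBlockUnion (ℓ + 1) Ω → ∀ Λ : Finset ↥Ω,
          covLRSub L hn (ℓ + 1) Ω a a₂ s (fun y : ↥Λ => y.1) * (covLRSub L hn (ℓ + 1) Ω a a₂ s (fun y : ↥Λ => y.1))⁻¹ = 1 ∧
          ∀ y y' : ↥Λ, |(covLRSub L hn (ℓ + 1) Ω a a₂ s (fun y : ↥Λ => y.1))⁻¹ y y'|
            ≤ c * Real.exp (-(δ * supNorm (y.1.1 - y'.1.1))) := by
  obtain ⟨δ, c, hδ, hc, h⟩ := cov116_regionLine_sub_decay d ℓ L hℓ amin aplus a2min a2plus ha ha2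
  refine ⟨δ, c, hδ, hc, ?_⟩
  intro n hn s a a₂ hs0 hs1 h1 h2 h5 h6 Ω hΩ Λ
  exact h n hn s a a₂ hs0 hs1 h1 h2 h5 h6 Ω hΩ (fun y : ↥Λ => y.1) Subtype.val_injective

/-- **(1.16) for the line with `Λ = Ω^{(j)}`**: `C_s^{(j)}(Ω) = (Δ_s^{(j)}(Ω) + a₂L_P^{−2}P)⁻¹` exists and decays, for every finite
union `Ω^{(j)}` of `L_P`-blocks, every `s ∈ [0,1]` (the REGION analogue of file 81's `cov237S_box_decay`). [folklore] -/
theorem cov116_regionLine_decay (d ℓ L : ℕ) [NeZero L] (hℓ : 1 ≤ ℓ) (amin aplus a2min a2plus : ℝ) (ha : 0 < amin)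
    (ha2 : 0 < a2min) :
    ∃ δ c : ℝ, 0 < δ ∧ 0 < c ∧
      ∀ (n : ℕ) (hn : 1 ≤ n) (s a a₂ : ℝ), 0 ≤ s → s ≤ 1 → amin ≤ a → a ≤ aplus → a2min ≤ a₂ → a₂ ≤ a2plus →
        ∀ (Ω : Finset (Fin (d + 1) → ℤ)), IsBlockUnion (ℓ + 1) Ω →
          covLR L hn (ℓ + 1) Ω a a₂ s * (covLR L hn (ℓ + 1) Ω a a₂ s)⁻¹ = 1 ∧
          ∀ y y' : ↥Ω, |(covLR L hn (ℓ + 1) Ω a a₂ s)⁻¹ y y'| ≤ c * Real.exp (-(δ * supNorm (y.1 - y'.1))) := by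
  obtain ⟨δ, c, hδ, hc, h⟩ := cov116_regionLine_sub_decay d ℓ L hℓ amin aplus a2min a2plus ha ha2
  refine ⟨δ, c, hδ, hc, ?_⟩
  intro n hn s a a₂ hs0 hs1 h1 h2 h5 h6 Ω hΩ
  exact h n hn s a a₂ hs0 hs1 h1 h2 h5 h6 Ω hΩ (id : ↥Ω → ↥Ω) Function.injective_id

/-- **B4 PROPOSITION 2.3 (1.17)–(1.18) FOR THE TWO-CUTOFF LINE, EVERY FINITE UNION `Ω^{(j)}` OF `L_P`-BLOCKS AND EVERY `Λ ⊆ Ω^{(j)}` —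
HYPOTHESIS-FREE**: there are `δ′, c′ > 0` in `(d, ℓ, L, window)` only such that for EVERY `n ≥ 1`, EVERY `s ∈ [0,1]`, every
admissible `a, a₂`, EVERY finite union `Ω^{(j)}` of `L_P`-blocks, EVERY injection `e : m → Ω^{(j)}` (range `Λ`) and EVERY weight `β`
with `0 ≤ β i ≤ |e i − z|_∞` off the range: `|C_{s,Λ}^{(j)}(Ω; e i, e i′) − C_s^{(j)}(Ω; e i, e i′)| ≤ c′·e^{−δ′(|e i − e i′|_∞ + β i + β i′)}`
(`B4Sect5Torus.deltaC_bound` on `covLR_hyp56`). [folklore] -/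
theorem cov118_regionLine_sub_delta (d ℓ L : ℕ) [NeZero L] (hℓ : 1 ≤ ℓ) (amin aplus a2min a2plus : ℝ) (ha : 0 < amin)
    (ha2 : 0 < a2min) :
    ∃ δ c : ℝ, 0 < δ ∧ 0 < c ∧
      ∀ (n : ℕ) (hn : 1 ≤ n) (s a a₂ : ℝ), 0 ≤ s → s ≤ 1 → amin ≤ a → a ≤ aplus → a2min ≤ a₂ → a₂ ≤ a2plus →
        ∀ (Ω : Finset (Fin (d + 1) → ℤ)), IsBlockUnion (ℓ + 1) Ω →
          ∀ {m : Type*} [Fintype m] [DecidableEq m] (e : m → ↥Ω), Function.Injective e →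
            ∀ β : m → ℝ, (∀ i, 0 ≤ β i) → (∀ i (z : ↥Ω), (¬ ∃ j, e j = z) → β i ≤ supNorm ((e i).1 - z.1)) →
              ∀ i i' : m,
                |(covLRSub L hn (ℓ + 1) Ω a a₂ s e)⁻¹ i i' - (covLR L hn (ℓ + 1) Ω a a₂ s)⁻¹ (e i) (e i')|
                  ≤ c * Real.exp (-(δ * (supNorm ((e i).1 - (e i').1) + β i + β i'))) := by
  obtain ⟨γ₀, c₀, κ, hγ, hc, hκ, -, -, hA⟩ := covLR_hyp56 d ℓ L hℓ amin aplus a2min a2plus ha ha2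
  have hKn : ∀ a : ℝ, 0 < a → 0 ≤ latticeConst (d + 1) a := fun a ha => latticeConst_nonneg (d + 1) ha.le
  have hc1 : 0 < c₀ + 1 := by linarith
  have hB := bigC_nonneg hKn hγ hc1.le hκ (K := latticeConst (d + 1))
  refine ⟨rate (latticeConst (d + 1)) γ₀ (c₀ + 1) κ / 4, bigC (latticeConst (d + 1)) γ₀ (c₀ + 1) κ + 1,
    by have := rate_pos hKn hγ hc1.le hκ; positivity, by positivity, ?_⟩
  intro n hn s a a₂ hs0 hs1 h1 h2 h5 h6 Ω hΩ m _ _ e he β hβ0 hβ i i'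
  have hA' := hyp56_mono (hA n hn s a a₂ hs0 hs1 h1 h2 h5 h6 Ω hΩ) (by linarith : c₀ ≤ c₀ + 1)
  have h := deltaC_bound hKn hγ hc1 hκ (rhoS_isPseudoDist Ω) (rhoS_sumBound Ω) hA' he hβ0
    (fun i z hz => by show β i ≤ supNorm ((e i).1 - z.1); exact hβ i z hz) i i'
  refine h.trans ?_
  exact mul_le_mul_of_nonneg_right (le_add_of_nonneg_right zero_le_one) (Real.exp_pos _).le

/-- **(1.17)–(1.18) for the line, `Λ ⊆ Ω^{(j)}` a `Finset`, with the printed weight `dist(·, Λ^c)`** (b04's `distCS`, complement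
inside `Ω^{(j)}`). [folklore] -/
theorem cov118_regionLine_finset_delta (d ℓ L : ℕ) [NeZero L] (hℓ : 1 ≤ ℓ) (amin aplus a2min a2plus : ℝ) (ha : 0 < amin)
    (ha2 : 0 < a2min) :
    ∃ δ c : ℝ, 0 < δ ∧ 0 < c ∧
      ∀ (n : ℕ) (hn : 1 ≤ n) (s a a₂ : ℝ), 0 ≤ s → s ≤ 1 → amin ≤ a → a ≤ aplus → a2min ≤ a₂ → a₂ ≤ a2plus →
        ∀ (Ω : Finset (Fin (d + 1) → ℤ)), IsBlockUnion (ℓ + 1) Ω → ∀ Λ : Finset ↥Ω, ∀ y y' : ↥Λ,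
          |(covLRSub L hn (ℓ + 1) Ω a a₂ s (fun y : ↥Λ => y.1))⁻¹ y y' - (covLR L hn (ℓ + 1) Ω a a₂ s)⁻¹ y.1 y'.1|
            ≤ c * Real.exp (-(δ * (supNorm (y.1.1 - y'.1.1) + distCS Λ y.1 + distCS Λ y'.1))) := by
  obtain ⟨δ, c, hδ, hc, h⟩ := cov118_regionLine_sub_delta d ℓ L hℓ amin aplus a2min a2plus ha ha2
  refine ⟨δ, c, hδ, hc, ?_⟩
  intro n hn s a a₂ hs0 hs1 h1 h2 h5 h6 Ω hΩ Λ y y'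
  refine h n hn s a a₂ hs0 hs1 h1 h2 h5 h6 Ω hΩ (fun y : ↥Λ => y.1) Subtype.val_injective
    (fun y : ↥Λ => distCS Λ y.1) (fun y => distCS_nonneg Λ y.1) (fun w z hz => distCS_le Λ w.1 ?_) y y'
  intro hzΛ
  exact hz ⟨⟨z, hzΛ⟩, rfl⟩

/-! ### §4 Non-vacuity (`d + 1 = 4`, two-run refinement `L = 3`, next block `L_P = 2`, window `a, a₂ ∈ [1∕2, 2]`) -/

/-- non-vacuity: (1.15) for the line on every finite union `Ω^{(j)} ⊂ ℤ⁴` of `2`-blocks, every `s ∈ [0,1]`, refinement `L = 3`. -/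
example : ∃ γ₀ γ₁ : ℝ, 0 < γ₀ ∧ 0 < γ₁ ∧
    γ₀ = min ((1 / 2 : ℝ) / (8 * (((3 : ℕ) : ℝ) + 1))) (1 / 8) * (min 2 (1 / 2 : ℝ) / (((1 : ℕ) : ℝ) + 1) ^ 2) ∧
    ∀ (n : ℕ) (hn : 1 ≤ n) (s a a₂ : ℝ), 0 ≤ s → s ≤ 1 → (1 / 2 : ℝ) ≤ a → a ≤ 2 → (1 / 2 : ℝ) ≤ a₂ → a₂ ≤ 2 →
      ∀ (Ω : Finset (Fin (3 + 1) → ℤ)), IsBlockUnion (1 + 1) Ω → ∀ ψ : ↥Ω → ℝ,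
        γ₀ * (ψ ⬝ᵥ ψ) ≤ ψ ⬝ᵥ (covLR 3 hn (1 + 1) Ω a a₂ s).mulVec ψ ∧
        ψ ⬝ᵥ (covLR 3 hn (1 + 1) Ω a a₂ s).mulVec ψ ≤ γ₁ * (ψ ⬝ᵥ ψ) :=
  cov115_regionLine_form_bounds 3 1 3 le_rfl (1 / 2) 2 (1 / 2) 2 (by norm_num) (by norm_num)

/-- non-vacuity: (1.16) for the line for every `Finset` `Λ` of unit sites of every finite union `Ω^{(j)} ⊂ ℤ⁴` of `2`-blocks,
every `s ∈ [0,1]`. -/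
example : ∃ δ c : ℝ, 0 < δ ∧ 0 < c ∧
    ∀ (n : ℕ) (hn : 1 ≤ n) (s a a₂ : ℝ), 0 ≤ s → s ≤ 1 → (1 / 2 : ℝ) ≤ a → a ≤ 2 → (1 / 2 : ℝ) ≤ a₂ → a₂ ≤ 2 →
      ∀ (Ω : Finset (Fin (3 + 1) → ℤ)), IsBlockUnion (1 + 1) Ω → ∀ Λ : Finset ↥Ω,
        covLRSub 3 hn (1 + 1) Ω a a₂ s (fun y : ↥Λ => y.1) * (covLRSub 3 hn (1 + 1) Ω a a₂ s (fun y : ↥Λ => y.1))⁻¹ = 1 ∧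
        ∀ y y' : ↥Λ, |(covLRSub 3 hn (1 + 1) Ω a a₂ s (fun y : ↥Λ => y.1))⁻¹ y y'|
          ≤ c * Real.exp (-(δ * supNorm (y.1.1 - y'.1.1))) :=
  cov116_regionLine_finset_decay 3 1 3 le_rfl (1 / 2) 2 (1 / 2) 2 (by norm_num) (by norm_num)

/-- non-vacuity: (1.17)–(1.18) for the line for every `Finset` `Λ` of unit sites of every finite union `Ω^{(j)} ⊂ ℤ⁴` of
`2`-blocks, every `s ∈ [0,1]`. -/
example : ∃ δ c : ℝ, 0 < δ ∧ 0 < c ∧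
    ∀ (n : ℕ) (hn : 1 ≤ n) (s a a₂ : ℝ), 0 ≤ s → s ≤ 1 → (1 / 2 : ℝ) ≤ a → a ≤ 2 → (1 / 2 : ℝ) ≤ a₂ → a₂ ≤ 2 →
      ∀ (Ω : Finset (Fin (3 + 1) → ℤ)), IsBlockUnion (1 + 1) Ω → ∀ Λ : Finset ↥Ω, ∀ y y' : ↥Λ,
        |(covLRSub 3 hn (1 + 1) Ω a a₂ s (fun y : ↥Λ => y.1))⁻¹ y y' - (covLR 3 hn (1 + 1) Ω a a₂ s)⁻¹ y.1 y'.1|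
          ≤ c * Real.exp (-(δ * (supNorm (y.1.1 - y'.1.1) + distCS Λ y.1 + distCS Λ y'.1))) :=
  cov118_regionLine_finset_delta 3 1 3 le_rfl (1 / 2) 2 (1 / 2) 2 (by norm_num) (by norm_num)

end Summit.QuantumFields.BalabanUV.T4Continuum.NE7K1LinRegionCov116
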